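import Literature.NumberTheory.Transcendental.MultipleZetaValues
import Literature.NumberTheory.Transcendental.MultipleZetaProofs
import HarnessLib

/-!
# Multiple zeta values — proofs: the depth-one bridge `ζ(k) = zetaValue k`

Sibling proof file of `Literature.NumberTheory.Transcendental.MultipleZetaValues` (D-0014).
It discharges the named fact `multipleZeta_singleton_eq_zetaValue` of that file: for `k ≥ 2` the
depth-one multiple zeta value `multipleZeta [k] = ∑_{n ≥ 1} n^{-k}` (Zagier's MZV with `r = 1`)
equals the real zeta value `zetaValue k = ∑' n : ℕ, 1 / n ^ k` of
`Literature.NumberTheory.Transcendental.PeriodsWave0` (whose `n = 0` summand is Mathlib's junk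
value `1 / 0 ^ k = 0`). The proof is the reindexing `mzvIndexSet 1 ≃ ℕ+`
(`multipleZeta_singleton_eq_tsum_pnat` of `MultipleZetaProofs`) followed by the insertion of the
vanishing `n = 0` term (Mathlib's `tsum_pnat_eq_tsum_of_eq_zero`); it is valid for every `k ≠ 0`
(`multipleZeta_singleton_eq_zetaValue_of_ne_zero`), in particular for `k ≥ 2` as the fact states.

## References

* D. Zagier, *Values of zeta functions and their applications*, First European Congress of
  Mathematics (Paris, 1992), Vol. II, Progr. Math. 120 (1994), 497–512, p. 497 eq. (2)
  (`r = 1`: `ζ(k) = ∑_{n ≥ 1} n^{-k}`). [Zagier1994] = [ZagierECM1994]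
-/

noncomputable section

namespace Literature.NumberTheory.Transcendental

/-- For every `k ≠ 0`, `multipleZeta [k] = zetaValue k`: both are `∑_{n ≥ 1} n^{-k}`, the series
defining `zetaValue k` having the extra vanishing summand `1 / 0 ^ k = 0` at `n = 0`
(Zagier 1994, p. 497, eq. (2) with `r = 1`). For `k = 1` both sides are the `tsum` junk value `0`
of the divergent harmonic series. [cite: Zagier1994, p. 497 eq. (2)] -/
theorem multipleZeta_singleton_eq_zetaValue_of_ne_zero {k : ℕ} (hk : k ≠ 0) :
    multipleZeta [k] = zetaValue k := by
  rw [multipleZeta_singleton_eq_tsum_pnat,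
    tsum_pnat_eq_tsum_of_eq_zero (f := fun n => 1 / (n : ℝ) ^ k) (by simp [hk])]
  rfl

/-- **Depth-one bridge** — discharge of the named fact `multipleZeta_singleton_eq_zetaValue` of
`Literature.NumberTheory.Transcendental.MultipleZetaValues`: for `k ≥ 2`,
`multipleZeta [k] = zetaValue k = ∑' n : ℕ, 1 / n ^ k` (Zagier 1994, p. 497, eq. (2) with
`r = 1`; cf. Mathlib's `zeta_nat_eq_tsum_of_gt_one`). [cite: Zagier1994, p. 497 eq. (2)] -/
theorem multipleZeta_singleton_eq_zetaValue_holds : multipleZeta_singleton_eq_zetaValue :=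
  fun _k hk => multipleZeta_singleton_eq_zetaValue_of_ne_zero (by omega)

end Literature.NumberTheory.Transcendental
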